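import Summits.SmoothPoincare4.SmoothPoincare4.Theses.EntropyRung
import Summits.SmoothPoincare4.SmoothPoincare4.Theorems.SubcylindricalExistence.Negative.Logic
import Summits.SmoothPoincare4.SmoothPoincare4.Theorems.EntropyRungSubcylindricalExistenceSchwarzschildReduction
import HarnessLib

/-!
# The transfer stub of line `green-blowup-conformal-entropy` in the Schwarzschild gauge is SPC4-hard
# given the rung (crux `EntropyRung.SubcylindricalExistence`, stmt-SmoothPoincare4-10871; leads c3/c5; negative side)

Reshape R-c3 of the line `green-blowup-conformal-entropy` reduces the crux ENT to ONE statement, its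
transfer stub Â_b `stub_schwarzschildBlowupExistence` (every closed smooth homotopy 4-sphere carries
Green data in the flat gauge WITH MASS, `G = a/‖y − φp‖² + b`, whose blow-up clears `ν_cyl + δ`):
`Â_b → ENT` is the landed `Summit.SmoothPoincare4.SmoothPoincare4.Theorems.subcylindricalExistence_of_schwarzschildBlowupExistence`
(p127092). Composing with the route's deciding theorem `closes : SubcylindricalRecognition → ENT → SPC4`
gives the conditional results recorded here: given the rung, Â_b proves SPC4
(`spc4_of_schwarzschildBlowupExistence`), and an exotic 4-sphere refutes Â_b
(`not_schwarzschildBlowupExistence_of_not_spc4`, the registered export). So Â_b carries the full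
difficulty of the summit along this route — it is crux-sized (its `S⁴` instance is the landed
`helper_schwarzschildBlowupExistence_sphereFour`). Unlike the exact gauge `b = 0` of R-c2
(`Negative/BlowupExistence`: SPC4 by positive-mass rigidity alone), the mass `ab ≥ 0` is free here, so
the entropy clause is what carries the content. Pure logic over landed theorems; nothing asserted
unconditionally.
-/

noncomputable section

-- the namespace of the crux's negative side repeats a component of the route namespace
set_option linter.dupNamespace false

open scoped Manifold ContDiff Topology RealInnerProductSpace ContinuousMap
open Set Filter MeasureTheory
open Literature.Geometry.Lorentzian
open Summit.SmoothPoincare4.SmoothPoincare4.Theses.EntropyRung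

namespace Summit.SmoothPoincare4.Cruxes.SubcylindricalExistence.Negative

/-- **Â_b ⇒ SPC4 given the rung**: blow-up existence in the Schwarzschild gauge (the transfer stub of
line `green-blowup-conformal-entropy`, reshape R-c3) implies the smooth 4-dimensional Poincaré conjecture
as soon as `SubcylindricalRecognition` holds — `closes` after the landed reduction
`subcylindricalExistence_of_schwarzschildBlowupExistence`. [folklore] -/
theorem spc4_of_schwarzschildBlowupExistence (hRung : SubcylindricalRecognition)
    (hA :
      ∀ (M : Type) [TopologicalSpace M] [T2Space M] [SecondCountableTopology M] [ChartedSpace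
        (EuclideanSpace ℝ (Fin 4)) M] [IsManifold (𝓡 4) ∞ M] [CompactSpace M] [T3Space M]
        [MeasurableSpace M] [BorelSpace M], M ≃ₕ Metric.sphere (0 : EuclideanSpace ℝ (Fin 5)) 1 → ∃
        g : PseudoRiemannianMetric (𝓡 4) ∞ (EuclideanSpace ℝ (Fin 4)) (TangentSpace (𝓡 4) : M → Type
        _), ∃ _ : g.HasLeviCivita, ∃ hg : g.IsRiemannian, ∃ p : M, ∃ G : M → ℝ, ∃ a b r : ℝ,
        (ContMDiffOn (𝓡 4) 𝓘(ℝ, ℝ) ∞ G {p}ᶜ ∧ (∀ x, x ≠ p → 0 < G x) ∧ (∀ x, x ≠ p →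
        g.scalarCurvature x * G x - 6 * g.dalembertian G x = 0) ∧ Tendsto G (𝓝[≠] p) atTop) ∧ (∀ x,
        0 ≤ g.scalarCurvature x) ∧ (∀ x, g.scalarCurvature x = 0 → x ∈ (extChartAt (𝓡 4) p).source ∧
        extChartAt (𝓡 4) p x ∈ Metric.closedBall (extChartAt (𝓡 4) p p) r) ∧ 0 < a ∧ 0 ≤ b ∧ 0 < r ∧
        (Metric.closedBall (extChartAt (𝓡 4) p p) r ⊆ (extChartAt (𝓡 4) p).target ∧ ∀ y ∈
        Metric.closedBall (extChartAt (𝓡 4) p p) r, ∀ X W : EuclideanSpace ℝ (Fin 4), g.val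
        ((extChartAt (𝓡 4) p).symm y) (mfderiv 𝓘(ℝ, EuclideanSpace ℝ (Fin 4)) (𝓡 4) (extChartAt (𝓡
        4) p).symm y X) (mfderiv 𝓘(ℝ, EuclideanSpace ℝ (Fin 4)) (𝓡 4) (extChartAt (𝓡 4) p).symm y W)
        = ⟪X, W⟫) ∧ (∀ y ∈ Metric.closedBall (extChartAt (𝓡 4) p p) r, y ≠ extChartAt (𝓡 4) p p → G
        ((extChartAt (𝓡 4) p).symm y) = a / ‖y - extChartAt (𝓡 4) p p‖ ^ 2 + b) ∧ ∃ δ : ℝ, 0 < δ ∧ ∀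
        τ : ℝ, 0 < τ → ∀ w : M → ℝ, ContMDiff (𝓡 4) 𝓘(ℝ, ℝ) ∞ w → w =ᶠ[𝓝 p] 0 → ∫ x, (4 * Real.pi *
        τ) ^ (-(4 : ℝ) / 2) * (w x) ^ 2 * (G x) ^ 4 ∂(riemannianMeasure
        (g.toContMDiffRiemannianMetric hg)) = 1 → Real.log 2 + Real.log Real.pi / 2 - 3 / 2 + δ ≤ ∫
        x, (4 * τ * ((G x)⁻¹ ^ 2 * g.gradSq w x) - (w x) ^ 2 * Real.log ((w x) ^ 2) - 4 * (w x) ^ 2)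
        * ((4 * Real.pi * τ) ^ (-(4 : ℝ) / 2) * (G x) ^ 4) ∂(riemannianMeasure
        (g.toContMDiffRiemannianMetric hg))) :
    _root_.SmoothPoincare4 :=
  closes hRung
    (_root_.Summit.SmoothPoincare4.SmoothPoincare4.Theorems.subcylindricalExistence_of_schwarzschildBlowupExistence
      hA)

/-- **¬SPC4 ⇒ ¬Â_b given the rung** (registered export `not_schwarzschildBlowupExistence_of_not_spc4` of
crux stmt-SmoothPoincare4-10871): an exotic 4-sphere kills the transfer stub of line
`green-blowup-conformal-entropy` (Schwarzschild gauge) once `SubcylindricalRecognition` holds. [folklore] -/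
theorem not_schwarzschildBlowupExistence_of_not_spc4 :
    Summit.SmoothPoincare4.SmoothPoincare4.Theses.EntropyRung.SubcylindricalRecognition → ¬
      _root_.SmoothPoincare4 → ¬ (∀ (M : Type) [TopologicalSpace M] [T2Space M]
      [SecondCountableTopology M] [ChartedSpace (EuclideanSpace ℝ (Fin 4)) M] [IsManifold (𝓡 4) ∞ M]
      [CompactSpace M] [T3Space M] [MeasurableSpace M] [BorelSpace M], M ≃ₕ Metric.sphere (0 :
      EuclideanSpace ℝ (Fin 5)) 1 → ∃ g : PseudoRiemannianMetric (𝓡 4) ∞ (EuclideanSpace ℝ (Fin 4))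
      (TangentSpace (𝓡 4) : M → Type _), ∃ _ : g.HasLeviCivita, ∃ hg : g.IsRiemannian, ∃ p : M, ∃ G
      : M → ℝ, ∃ a b r : ℝ, (ContMDiffOn (𝓡 4) 𝓘(ℝ, ℝ) ∞ G {p}ᶜ ∧ (∀ x, x ≠ p → 0 < G x) ∧ (∀ x, x ≠
      p → g.scalarCurvature x * G x - 6 * g.dalembertian G x = 0) ∧ Tendsto G (𝓝[≠] p) atTop) ∧ (∀
      x, 0 ≤ g.scalarCurvature x) ∧ (∀ x, g.scalarCurvature x = 0 → x ∈ (extChartAt (𝓡 4) p).source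
      ∧ extChartAt (𝓡 4) p x ∈ Metric.closedBall (extChartAt (𝓡 4) p p) r) ∧ 0 < a ∧ 0 ≤ b ∧ 0 < r ∧
      (Metric.closedBall (extChartAt (𝓡 4) p p) r ⊆ (extChartAt (𝓡 4) p).target ∧ ∀ y ∈
      Metric.closedBall (extChartAt (𝓡 4) p p) r, ∀ X W : EuclideanSpace ℝ (Fin 4), g.val
      ((extChartAt (𝓡 4) p).symm y) (mfderiv 𝓘(ℝ, EuclideanSpace ℝ (Fin 4)) (𝓡 4) (extChartAt (𝓡 4)
      p).symm y X) (mfderiv 𝓘(ℝ, EuclideanSpace ℝ (Fin 4)) (𝓡 4) (extChartAt (𝓡 4) p).symm y W) =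
      ⟪X, W⟫) ∧ (∀ y ∈ Metric.closedBall (extChartAt (𝓡 4) p p) r, y ≠ extChartAt (𝓡 4) p p → G
      ((extChartAt (𝓡 4) p).symm y) = a / ‖y - extChartAt (𝓡 4) p p‖ ^ 2 + b) ∧ ∃ δ : ℝ, 0 < δ ∧ ∀ τ
      : ℝ, 0 < τ → ∀ w : M → ℝ, ContMDiff (𝓡 4) 𝓘(ℝ, ℝ) ∞ w → w =ᶠ[𝓝 p] 0 → ∫ x, (4 * Real.pi * τ) ^
      (-(4 : ℝ) / 2) * (w x) ^ 2 * (G x) ^ 4 ∂(riemannianMeasure (g.toContMDiffRiemannianMetric hg))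
      = 1 → Real.log 2 + Real.log Real.pi / 2 - 3 / 2 + δ ≤ ∫ x, (4 * τ * ((G x)⁻¹ ^ 2 * g.gradSq w
      x) - (w x) ^ 2 * Real.log ((w x) ^ 2) - 4 * (w x) ^ 2) * ((4 * Real.pi * τ) ^ (-(4 : ℝ) / 2) *
      (G x) ^ 4) ∂(riemannianMeasure (g.toContMDiffRiemannianMetric hg))) :=
  fun hRung h hA ↦ h (spc4_of_schwarzschildBlowupExistence hRung hA)

end Summit.SmoothPoincare4.Cruxes.SubcylindricalExistence.Negative

end
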